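import Literature.NumberTheory.LFunctions.WeilCriterionProofs
import Summits.RiemannHypothesis.RiemannHypothesis.Theorems.SignConeEnvelopeCutoff
import Summits.RiemannHypothesis.RiemannHypothesis.Theorems.SignConeSignConeOscillatoryEnvelope

/-!
# Status of the crux `SignConeOscillatory`: RH-equivalent inside the route; content threshold `a > (log 2)/2`
(route `SignCone`, item stmt-RiemannHypothesis-16302; HELPER file, `--supports` — it does not close the item)

Complements `SignConeEnvelopeCore.lean`, `SignConeEnvelopeCutoff.lean`,
`SignConeSignConeOscillatoryEnvelope.lean` and `SignConeSignConeOscillatoryWitness.lean`: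

* `signConeExact_of_weilPositivity`: Weil positivity gives the EXACT (slack-free) sign-cone inequality
  at every cutoff — the hypothesis of the route decl `ExactConeRigidity`, verbatim;
* `signConeOscillatory_iff_riemannHypothesis_of`, `signConeInequality_iff_riemannHypothesis_of`,
  `signConeExact_iff_riemannHypothesis_of`: GIVEN the route's sibling cruxes (`ConeMagnification`,
  `SignConeDuality`, `SignConeFarField`; resp. `ExactConeRigidity`) the crux, the target and the exact
  form are each EQUIVALENT to the summit `Summit.RiemannHypothesis` — `→` is the route's deciding
  theorem `closes` (resp. `ExactConeRigidity` itself), `←` is the envelope through the in-tree Weil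
  criterion `weil_criterion_holds : RiemannHypothesis ↔ WeilPositivity`. So inside this route the item
  is exactly as strong as RH: a proof of it is a proof of RH from the sibling cruxes, a refutation of it
  is a refutation of RH;
* `autocorrSum_eq_zero_of_lt`, `autocorrSum_eq_zero_of_le`, `not_oscillatory_of_le_log_two_half`: the
  autocorrelation sum `F = Σᵢ gᵢ ⋆ g̃ᵢ` of tests supported in `[-a, a]` vanishes on `|t| ≥ 2a`, so for
  `a ≤ (log 2)/2` the oscillatory node-nonnegative class is EMPTY and the item is vacuous there; the
  witness of `SignConeSignConeOscillatoryWitness.lean` shows it is non-empty at `a = 1/2`, so the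
  content of the item starts exactly at the threshold `a > (log 2)/2` (and is settled unconditionally up
  to `(log 3)/2` by `signConeOscillatory_upTo_log_three_half`).
-/

noncomputable section

-- the summit-side namespace `Summit.RiemannHypothesis.RiemannHypothesis.…` (D-0017: Sub = Summit) repeats a component
set_option linter.dupNamespace false

open scoped BigOperators ComplexConjugate
open Complex MeasureTheory Set Filter

namespace Summit.RiemannHypothesis.RiemannHypothesis.Theorems.SignCone

open Literature.NumberTheory.LFunctions
open Summit.RiemannHypothesis.RiemannHypothesis.Theorems.RuelleBandCofiniteCriticalLine
open Summit.RiemannHypothesis.RiemannHypothesis.Theses.SignCone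

variable {k : ℕ}

/-! ## The exact sign-cone inequality at every cutoff from Weil positivity -/

/-- `WeilPositivity` implies the EXACT (slack-free) sign-cone inequality `0 ≤ Re W_ar(F)` at every
cutoff — the hypothesis of the route decl `ExactConeRigidity`, verbatim over Mathlib primitives
(`re_weilArchPolar_nonneg` with `Re Q(gᵢ) ≥ 0` from Weil positivity). [folklore] -/
theorem signConeExact_of_weilPositivity (hW : WeilPositivity) :
    ∀ a : ℝ, 0 < a → ∀ (k : ℕ) (g : Fin k → ℝ → ℂ), (∀ i, (ContDiff ℝ ((⊤ : ℕ∞) : WithTop ℕ∞) (g i) ∧ HasCompactSupport (g i)) ∧ tsupport (g i) ⊆ Set.Icc (-a) a) → let F : ℝ → ℂ := fun t => ∑ i, MeasureTheory.convolution (g i) (fun u => (starRingEnd ℂ) ((g i) (-u))) (ContinuousLinearMap.mul ℂ ℂ) MeasureTheory.MeasureSpace.volume t; (∀ n : ℕ, 2 ≤ n → 0 ≤ (F (Real.log n)).re) → let M : ℂ → ℂ := fun s => ∫ u : ℝ, F u * Complex.exp ((s - 1 / 2) * u); 0 ≤ (M 0 + M 1 + ((1 / (2 * Real.pi) : ℂ)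 * (∫ t : ℝ, M (1 / 2 + t * Complex.I) * ((Complex.digamma (1 / 4 + t / 2 * Complex.I)).re : ℂ)) - F 0 * (Real.log Real.pi : ℂ))).re := by
  intro a _ k g hg F hn M
  exact re_weilArchPolar_nonneg (g := g) (F := F) rfl (fun i => (hg i).1)
    (fun i => hW _ (hg i).1) hn

/-! ## The crux, the target and the exact form are RH-equivalent inside the route -/

/-- **The crux is RH-equivalent inside the route.** Given the route's other three cruxes
(`ConeMagnification`, `SignConeDuality`, `SignConeFarField`), `SignConeOscillatory` holds iff the
summit does: `→` is the proof term of the route's deciding theorem `closes` (conic duality at each cutoff feeds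
magnification), `←` is `signConeOscillatory_of_riemannHypothesis` (explicit formula + easy half of Weil's
criterion, both in-tree). [folklore] -/
theorem signConeOscillatory_iff_riemannHypothesis_of (h₂ : ConeMagnification) (h₃ : SignConeDuality)
    (h₄ : SignConeFarField) : SignConeOscillatory ↔ Summit.RiemannHypothesis :=
  -- the proof term of the route's deciding theorem, written out over the item decls (the gate-written `closes`
  -- changed its binders in revs 5/7/8 of the route file; this file must not depend on their order)
  ⟨fun h₁ => h₂ (fun a ha => h₃ a ha (signConeInequality_iff.2 ⟨h₁, h₄⟩ a ha)),
    fun hRH => signConeOscillatory_of_riemannHypothesis hRH⟩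

/-- Likewise for the route's target: given `ConeMagnification` and `SignConeDuality`,
`SignConeInequality ↔ Summit.RiemannHypothesis` (the far-field half of the target is supplied by the
target itself). [folklore] -/
theorem signConeInequality_iff_riemannHypothesis_of (h₂ : ConeMagnification) (h₃ : SignConeDuality) :
    SignConeInequality ↔ Summit.RiemannHypothesis :=
  ⟨fun h => h₂ (fun a ha => h₃ a ha (h a ha)),
    fun hRH => signConeInequality_of_riemannHypothesis hRH⟩

/-- Likewise for the exact chain: given `ExactConeRigidity`, its own hypothesis (the slack-free
sign-cone inequality at every cutoff) holds iff the summit does (`←` through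
`weil_criterion_holds : RiemannHypothesis ↔ WeilPositivity` and `signConeExact_of_weilPositivity`). [folklore] -/
theorem signConeExact_iff_riemannHypothesis_of (hR : ExactConeRigidity) :
    (∀ a : ℝ, 0 < a → ∀ (k : ℕ) (g : Fin k → ℝ → ℂ), (∀ i, (ContDiff ℝ ((⊤ : ℕ∞) : WithTop ℕ∞) (g i) ∧ HasCompactSupport (g i)) ∧ tsupport (g i) ⊆ Set.Icc (-a) a) → let F : ℝ → ℂ := fun t => ∑ i, MeasureTheory.convolution (g i) (fun u => (starRingEnd ℂ) ((g i) (-u))) (ContinuousLinearMap.mul ℂ ℂ) MeasureTheory.MeasureSpace.volume t; (∀ n : ℕ, 2 ≤ n → 0 ≤ (F (Real.log n)).re) → let M : ℂ → ℂ := fun s => ∫ u : ℝ, F u * Complex.exp ((s - 1 / 2) * u); 0 ≤ (M 0 + M 1 + ((1 / (2 * Real.pi) : ℂ) * (∫ t : ℝ, M (1 / 2 + t * Complex.I) * ((Complex.digamma (1 / 4 + t / 2 * Complex.I)).re : ℂ)) - F 0 * (Real.log Real.pi : ℂ))).re) ↔ Summit.RiemannHypothesis :=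
  ⟨fun h => hR h, fun hRH =>
    signConeExact_of_weilPositivity
      ((show _root_.RiemannHypothesis ↔ WeilPositivity from weil_criterion_holds).1 hRH)⟩

/-- The sandwich in one line: `WeilPositivity → SignConeOscillatory → (siblings) → RiemannHypothesis
→ WeilPositivity`; hence, given the sibling cruxes, the crux is also equivalent to Weil positivity
itself. [folklore] -/
theorem signConeOscillatory_iff_weilPositivity_of (h₂ : ConeMagnification) (h₃ : SignConeDuality)
    (h₄ : SignConeFarField) : SignConeOscillatory ↔ WeilPositivity :=
  (signConeOscillatory_iff_riemannHypothesis_of h₂ h₃ h₄).trans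
    (show _root_.RiemannHypothesis ↔ WeilPositivity from weil_criterion_holds)

/-! ## Content threshold: the oscillatory class is empty for `a ≤ (log 2)/2` -/

/-- If every `gᵢ` is supported in `[-a, a]` then `F = Σᵢ gᵢ ⋆ g̃ᵢ` vanishes off `[-2a, 2a]`
(`support (g ⋆ h) ⊆ support h + support g`). [folklore] -/
theorem autocorrSum_eq_zero_of_lt {a : ℝ} (g : Fin k → ℝ → ℂ)
    (hs : ∀ i, tsupport (g i) ⊆ Icc (-a) a) {t : ℝ} (ht : 2 * a < |t|) :
    (fun t => ∑ i, weilConv (g i) (weilReflect (g i)) t) t = 0 := by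
  refine Finset.sum_eq_zero fun i _ => ?_
  by_contra h
  have hmem : t ∈ Function.support (weilConv (g i) (weilReflect (g i))) := h
  unfold weilConv at hmem
  have h2 := support_convolution_subset_swap (ContinuousLinearMap.mul ℂ ℂ) hmem
  rw [Set.mem_add] at h2
  obtain ⟨u, hu, v, hv, huv⟩ := h2
  subst huv
  have hv' : v ∈ Icc (-a) a := hs i (subset_tsupport _ hv)
  have hu' : -u ∈ Icc (-a) a := by
    refine hs i (subset_tsupport _ ?_)
    rw [Function.mem_support] at hu ⊢
    simpa [weilReflect] using hu
  have hle : |u + v| ≤ 2 * a := by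
    rw [abs_le]
    constructor <;> linarith [hv'.1, hv'.2, hu'.1, hu'.2]
  linarith

/-- Hence, by continuity, `F(t) = 0` for `|t| ≥ 2a` when `a > 0` and the `gᵢ` are Weil tests. [folklore] -/
theorem autocorrSum_eq_zero_of_le {a : ℝ} (ha : 0 < a) (g : Fin k → ℝ → ℂ)
    (hg : ∀ i, IsWeilTest (g i)) (hs : ∀ i, tsupport (g i) ⊆ Icc (-a) a) {t : ℝ}
    (ht : 2 * a ≤ |t|) : (fun t => ∑ i, weilConv (g i) (weilReflect (g i)) t) t = 0 := by
  set F : ℝ → ℂ := fun t => ∑ i, weilConv (g i) (weilReflect (g i)) t with hF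
  have hFt : IsWeilTest F :=
    stub_branchesContinuous_isWeilTest_sum _ fun i _ => (hg i).weilConv (hg i).weilReflect
  have hU : EqOn F 0 {s : ℝ | 2 * a < |s|} := fun s hs' => autocorrSum_eq_zero_of_lt g hs hs'
  have hcl : EqOn F 0 (closure {s : ℝ | 2 * a < |s|}) := hU.closure hFt.1.continuous continuous_const
  refine hcl (Metric.mem_closure_iff.2 fun ε hε => ?_)
  have ht0 : t ≠ 0 := fun h0 => by
    rw [h0, abs_zero] at ht
    linarith
  rcases lt_or_gt_of_ne ht0 with hneg | hpos
  · refine ⟨t - ε / 2, ?_, ?_⟩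
    · show 2 * a < |t - ε / 2|
      rw [abs_of_neg (by linarith)]
      rw [abs_of_neg hneg] at ht
      linarith
    · rw [Real.dist_eq, show t - (t - ε / 2) = ε / 2 by ring, abs_of_pos (by linarith)]
      linarith
  · refine ⟨t + ε / 2, ?_, ?_⟩
    · show 2 * a < |t + ε / 2|
      rw [abs_of_pos (by linarith)]
      rw [abs_of_pos hpos] at ht
      linarith
    · rw [Real.dist_eq, show t - (t + ε / 2) = -(ε / 2) by ring, abs_neg, abs_of_pos (by linarith)]
      linarith

/-- **The oscillatory class is empty below the first node.** For `0 < a ≤ (log 2)/2` the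
autocorrelation sum `F` of Weil tests supported in `[-a, a]` vanishes on `|t| ≥ log 2`, so the
oscillation hypothesis `∃ t, log 2 ≤ |t| ∧ Re F(t) < 0` of `SignConeOscillatory` is never met: the
item has content exactly for cutoffs `a > (log 2)/2` (non-empty already at `a = 1/2` by
`exists_oscillatory_signCone_test_half`). [folklore] -/
theorem not_oscillatory_of_le_log_two_half {a : ℝ} (ha : 0 < a) (hle : a ≤ Real.log 2 / 2)
    (g : Fin k → ℝ → ℂ) (hg : ∀ i, IsWeilTest (g i)) (hs : ∀ i, tsupport (g i) ⊆ Icc (-a) a) :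
    ¬ ∃ t : ℝ, Real.log 2 ≤ |t| ∧
      ((fun t => ∑ i, weilConv (g i) (weilReflect (g i)) t) t).re < 0 := by
  rintro ⟨t, ht, hneg⟩
  rw [autocorrSum_eq_zero_of_le ha g hg hs (by linarith), Complex.zero_re] at hneg
  exact lt_irrefl _ hneg

/-- The same for the route's verbatim class: for `0 < a ≤ (log 2)/2` NO family of tests supported in
`[-a, a]` is oscillatory, so `SignConeOscillatory` restricted to such cutoffs holds vacuously
(compare `signConeOscillatory_upTo_log_three_half`, which settles `a ≤ (log 3)/2` non-vacuously). [folklore] -/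
theorem signConeOscillatory_upTo_log_two_half_vacuous :
    ∀ a : ℝ, 0 < a → a ≤ Real.log 2 / 2 → ∀ (k : ℕ) (g : Fin k → ℝ → ℂ), (∀ i, (ContDiff ℝ ((⊤ : ℕ∞) : WithTop ℕ∞) (g i) ∧ HasCompactSupport (g i)) ∧ tsupport (g i) ⊆ Set.Icc (-a) a) → let F : ℝ → ℂ := fun t => ∑ i, MeasureTheory.convolution (g i) (fun u => (starRingEnd ℂ) ((g i) (-u))) (ContinuousLinearMap.mul ℂ ℂ) MeasureTheory.MeasureSpace.volume t; ¬ ∃ t : ℝ, Real.log 2 ≤ |t| ∧ (F t).re < 0 :=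
  fun _ ha hle _ g hg => not_oscillatory_of_le_log_two_half ha hle g (fun i => (hg i).1) fun i => (hg i).2

end Summit.RiemannHypothesis.RiemannHypothesis.Theorems.SignCone

end
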